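import Mathlib.CategoryTheory.Limits.Shapes.Countable
import Mathlib.Data.Countable.Basic
import Literature.AlgebraicGeometry.Frobenioids.CoproductCompletionFinite
import HarnessLib

/-!
# Frobenioids I, §0 p. 16: `C^⊤` is a category of countably connected type

Mochizuki, *The geometry of Frobenioids I: the general theory*, Kyushu J. Math. **62** (2008)
293–400, §0 "Categories", kurims text p. 16 [cite: MochizukiFrdI2008, §0 p.16]:

> "Thus, `C^⊥` (respectively, `C^⊤`) is a category of finitely (respectively, countably)
> connected type."

`CoproductCompletionFinite.lean` (abc-iut-found) proves the `C^⊥` half and supplies the generic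
machinery (`CoproductCompletion.sigma`, `sigmaCofanSub`, `sigmaCofanSubIsColimit`,
`bijective_of_isColimit`) for any full subcategory of `FormalCoproduct C`. This file proves the
countable twin for `C^⊤ = CountableCoproductCompletion C` (`IsOfCountablyConnectedType`, FrdI §0
p. 15): countable coproducts exist (a countable formal coproduct of countable formal coproducts);
every object is the coproduct of its one-index (connected) components, re-indexed by a countable
type in `Type` (a subtype of `ℕ`, as the typed clause requires); and connected (= one-index) objects
see colimit cofans as disjoint unions of `Hom`-sets. Theorems only.
-/

namespace Literature.AlgebraicGeometry.Frobenioids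

open CategoryTheory CategoryTheory.Limits CoproductCompletion

universe w v u

variable {C : Type u} [Category.{v} C]

/-- `C^⊤` has the coproduct of every countable family (the formal coproduct with `Σ`-index set).
[cite: MochizukiFrdI2008, §0 p.16] -/
theorem hasCoproduct_family_countableCoproductCompletion {J : Type} [Countable J]
    (F : J → CountableCoproductCompletion.{w} C) : HasCoproduct F := by
  haveI : ∀ j, Countable (F j).obj.I := fun j => (F j).property
  have hS : countableFormalCoproducts.{w} C (sigma fun j => (F j).obj) :=
    show Countable (Σ j, (F j).obj.I) from inferInstance
  exact ⟨⟨⟨sigmaCofanSub F hS, sigmaCofanSubIsColimit F hS⟩⟩⟩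

/-- `C^⊤` "is closed under formation of countable coproducts". [cite: MochizukiFrdI2008, §0 p.16] -/
theorem hasCountableCoproducts_countableCoproductCompletion :
    HasCountableCoproducts (CountableCoproductCompletion.{w} C) := by
  refine ⟨fun J _ => ⟨fun K => ?_⟩⟩
  haveI := hasCoproduct_family_countableCoproductCompletion (K.obj ∘ Discrete.mk)
  exact hasColimit_of_iso Discrete.natIsoFunctor

/-- Every object of `C^⊤` is a countable coproduct of (connected) one-point objects `incl (X i)`,
indexed by a countable type in `Type` (a subtype of `ℕ` in bijection with the index set).
[cite: MochizukiFrdI2008, §0 p.16] -/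
theorem exists_cofan_countableCoproductCompletion (X : CountableCoproductCompletion.{w} C) :
    ∃ (ι : Type) (_ : Countable ι) (F : ι → CountableCoproductCompletion.{w} C),
      (∀ i, IsConnectedObj (F i)) ∧ ∃ c : Cofan F, Nonempty (IsColimit c) ∧ Nonempty (c.pt ≅ X) := by
  haveI : Countable X.obj.I := X.property
  obtain ⟨f, hf⟩ := Countable.exists_injective_nat X.obj.I
  let e : X.obj.I ≃ Set.range f := Equiv.ofInjective f hf
  let F : Set.range f → CountableCoproductCompletion.{w} C := fun k =>
    (toCountableCoproductCompletion.{w} C).obj (X.obj.obj (e.symm k))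
  have hS : countableFormalCoproducts.{w} C (sigma fun k => (F k).obj) :=
    show Countable (Σ _ : Set.range f, PUnit.{w + 1}) from inferInstance
  refine ⟨Set.range f, inferInstance, F, fun k => isConnectedObj_toCountableCoproductCompletion _,
    sigmaCofanSub F hS, ⟨sigmaCofanSubIsColimit F hS⟩, ⟨(countableFormalCoproducts.{w} C).isoMk ?_⟩⟩
  -- `∐ₖ incl (X (e⁻¹ k)) ≅ X` in `FormalCoproduct C`
  let e' : (Σ _ : Set.range f, PUnit.{w + 1}) ≃ X.obj.I :=
    { toFun := fun p => e.symm p.1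
      invFun := fun i => ⟨e i, PUnit.unit⟩
      left_inv := fun p => by
        obtain ⟨k, u⟩ := p
        simp only [Equiv.apply_symm_apply]
      right_inv := fun i => Equiv.symm_apply_apply e i }
  exact FormalCoproduct.isoOfComponents e' fun _ => Iso.refl _

/-- **FrdI §0 p. 16: `C^⊤` is a category of countably connected type.** [cite: MochizukiFrdI2008, §0 p.16] -/
theorem isOfCountablyConnectedType_countableCoproductCompletion :
    IsOfCountablyConnectedType (CountableCoproductCompletion.{w} C) where
  hasCountableCoproducts := hasCountableCoproducts_countableCoproductCompletion
  exists_cofan := exists_cofan_countableCoproductCompletion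
  bijective := fun {ι} _ {F} c hc B hB => by
    obtain ⟨⟨i⟩, hs⟩ := (isConnectedObj_iff_countableCoproductCompletion B).mp hB
    haveI : Unique B.obj.I := uniqueOfSubsingleton i
    haveI : ∀ k, Countable (F k).obj.I := fun k => (F k).property
    exact bijective_of_isColimit (P := countableFormalCoproducts.{w} C)
      (show Countable (Σ k : ι, (F k).obj.I) from inferInstance) c hc B

end Literature.AlgebraicGeometry.Frobenioids
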